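import Literature.MathematicalPhysics.QuantumManyBody.ScatteringLengthTruncationHardCore
import HarnessLib

/-!
# Cutting out the core of a potential: FGJMOT Lemma 3.4 / Fournais–Solovej II, Lemma 3.2

Topic `Literature/MathematicalPhysics/QuantumManyBody`, namespace `BoseGas` (provefact
`Literature.MathematicalPhysics.QuantumManyBody.BoseGas.Junge2026_neumannBox_pinnedLowerBound`; brick:
the second input of [FournaisEtAl2024, Prop. 2.1] — their Lemma 3.4, "a reformulation of [FS2]",
i.e. of [FournaisSolovej2022, Thm. 1.6 / Lemma 3.2] (S. Fournais, J. P. Solovej, *The energy of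
dilute Bose gases II: the general case*, Invent. Math. 232 (2023), arXiv:2108.12022, §3.3)).

**The result.** For a bounded measurable radial profile `w ≤ M` of finite range `R₀` with scattering
length `a > 0` and "tail mass" `m(ρ) = ∫_ρ^{R₀} ½w(s)s² ds` (so that `∫_{|x|>ρ} w(|x|)dx = 8π m(ρ)`):
for every `S > 0` with `8πSa < ∫ w`, i.e. `S a < m(0)`, there is a radius `0 < R_S < R₀` with
`m(R_S) = S a` (`∫ w_S = 8πSa` for the tail `w_S = w·1_{(R_S,∞)}`), and
`a ≥ a(w_S) ≥ a(1 - 2/S)` (`FournaisEtAl2024_lemma34`; FGJMOT print `1 - C₀S⁻¹` with a universal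
`C₀`, Fournais–Solovej the sharper `1 - (1 + √5/√T)T⁻¹`). In FGJMOT's Prop. 2.1 the lemma is
applied after Lemma 3.3, i.e. to `V ≤ K` bounded, which is the generality proved here (the tree's
scattering theory of `PeriodicBoseGasScattering*.lean` is for bounded profiles).

**The proof** follows [FournaisSolovej2022, Lemma 3.2] (file `p0010` of the arXiv text):
* `radialProfile_mul_tailMass_le`: `8πa_S = ∫ w_S φ_S ≥ φ_S(R_S) ∫ w_S`, i.e.
  `φ_S(R_S)·m(R_S) ≤ a_S` (FS (3.17)–(3.18)), and the same for `w`: `φ(R_S) m(R_S) ≤ a` (3.19) —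
  from `∫₀^{R₀} ½ws²f = a` (`integral_pot_sq_profile`) and the monotonicity of the profile in `r`;
* `odeScatteringLength_le_tail_add` (the regime `R_S ≲ a`, FS (3.20)–(3.22)): the trial function
  `u = 1_{r ≥ R_S}(φ_S - c/r)`, `c = R_Sφ_S(R_S)`, in the functional of `w` (`= w_S` where
  `u ≠ 0`). We write it as the product `φ_S·h`, `h = 1 - R_S/u_S(r)` (`u_S` the radial solution of
  the tail, `u_S = r` on the flat core), and use the product identity of
  `ScatteringLengthTruncationHardCore.lean` (`profile_mul_energy_eq`: the cross term `E₂` of FS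
  vanishes by the flux form of the radial equation); the remaining term is
  `∫ r²φ_S²h'² = (R_S²/C₀²)∫(u_S'/u_S)² ≤ (R_S²/C₀)∫u_S'/u_S² ≤ R_S/C₀ = c` (`0 ≤ u_S' ≤ C₀ = u_S'(R₀)`),
  giving **`a ≤ a_S + R_Sφ_S(R_S)`** (FS bound `E₃` by `c²(R_S⁻¹ + aT R_S⁻²)` instead, which is
  what yields their sharper constant; `c ≤ R_S a_S/(aS)` by the first bullet);
* `odeScatteringLength_le_core_add_tail` (the regime `R_S ≳ a`, FS (3.23)–(3.24)): on the core
  `φ = c₀φ_<` (`φ_<` the solution for `w_< = w·1_{r ≤ R_S}`; locality of the Volterra equation,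
  `radialSol_congr_Iic`), `φ ≤ φ_S` (`radialProfile_antitone_pot`), whence
  `a = ∫½ws²φ ≤ φ(R_S)a_</(1 - a_</R_S) + a_S`;
* `FournaisEtAl2024_lemma34`: `R_S` by the intermediate value theorem; `R_S ≤ 2a` → first regime,
  `R_S > 2a` → second; either way `a - a_S ≤ 2a/S`.

No definitions (`m`, `w_S`, `w_<` are written out).

## References

* [FournaisEtAl2024] S. Fournais, L. Junge, T. Girardot, L. Morin, M. Olivieri, A. Triay, *The free
  energy of dilute Bose gases at low temperatures interacting via strong potentials*,
  arXiv:2408.14222, Ann. Henri Poincaré (2026): Lemma 3.4, Prop. 2.1 and its proof ((3.10)).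
* [FournaisSolovej2022] S. Fournais, J. P. Solovej, *The energy of dilute Bose gases II: the
  general case*, Invent. Math. 232 (2023) 863–994, doi:10.1007/s00222-022-01175-0,
  arXiv:2108.12022: Thm. 1.6, §3.3 Lemma 3.2 and its proof, Remark 3.3.
* [LSSY2005] E. H. Lieb, R. Seiringer, J. P. Solovej, J. Yngvason, *The Mathematics of the Bose Gas
  and its Condensation*, Birkhäuser 2005: (2.4)–(2.5), App. C Thm. C.1, Lemma C.2.
-/

noncomputable section

open MeasureTheory Set Filter Topology Metric
open scoped ENNReal NNReal

namespace Literature.MathematicalPhysics.QuantumManyBody.BoseGas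

/-! ### The energy of `fH` on `(0, T]` with the bulk term as a hypothesis -/

section General

variable {w : ℝ → ℝ≥0∞} {M R R₀ a₂ T θ₁ C_H B : ℝ} {f H : ℝ → ℝ}

/-- **The energy of `fH` on `(0, T]`**, `f` the profile of a bounded potential, `H` a `C¹` function
with `0 ≤ H ≤ 1`, `H' = 0` on `(0, R]`, `|H'| ≤ C_H` on `[R, R + θ₁]`: it is at most
`T²f'(T) + (R+1)²C_H²θ₁ + B` where `B` bounds `∫_{(R+θ₁, T]} r²f²H'²` (product identity
`profile_mul_energy_eq`). [cite: FournaisSolovej2022, Lemma 3.2, proof (E₁ + E₂ + E₃); LSSY2005, App. C, (C.8)] -/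
theorem lintegral_rayDensity_profile_mul_le_of (hw : Measurable w) (hM : ∀ r, w r ≤ ENNReal.ofReal M)
    (hM0 : 0 ≤ M) (hR : 0 < R) (hθ₁0 : 0 < θ₁) (hθ₁1 : θ₁ ≤ 1) (hRT : R + θ₁ ≤ T) (ha₂0 : 0 ≤ a₂)
    (hf : f = radialProfile w R₀) (hf0 : ∀ r, 0 < f r) (hf1 : ∀ r, f r ≤ 1)
    (hfT : T ^ 2 * deriv f T = a₂) (hH : ContDiff ℝ 1 H) (hH01 : ∀ r, 0 ≤ H r ∧ H r ≤ 1)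
    (hH'0 : ∀ r, r ≤ R → deriv H r = 0) (hH'C : ∀ r ∈ Icc R (R + θ₁), |deriv H r| ≤ C_H)
    (hmain : ∫⁻ r in Ioc (R + θ₁) T, ENNReal.ofReal (r ^ 2 * f r ^ 2 * deriv H r ^ 2) ≤ ENNReal.ofReal B) :
    ∫⁻ r in Ioc 0 T, rayDensity w (fun r => f r * H r) r ≤
      ENNReal.ofReal a₂ + (ENNReal.ofReal ((R + 1) ^ 2 * C_H ^ 2 * θ₁) + ENNReal.ofReal B) := by
  have hT0 : 0 < T := by linarith
  have hfc : ContDiff ℝ 1 f := hf ▸ contDiff_radialProfile hw hM hM0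
  have hG₁c : ContDiff ℝ 1 fun r => f r * H r := hfc.mul hH
  have hid := profile_mul_energy_eq hw hM hM0 R₀ hT0 hH
  rw [← hf] at hid
  have hIc : Continuous fun r => r ^ 2 * f r ^ 2 * deriv H r ^ 2 := by
    have := hfc.continuous; have := hH.continuous_deriv le_rfl; fun_prop
  have hIint : IntegrableOn (fun r => r ^ 2 * f r ^ 2 * deriv H r ^ 2) (Ioc 0 T) :=
    hIc.integrableOn_Icc.mono_set Ioc_subset_Icc_self
  have hInn : 0 ≤ ∫ r in Ioc 0 T, r ^ 2 * f r ^ 2 * deriv H r ^ 2 :=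
    setIntegral_nonneg measurableSet_Ioc fun r _ => by positivity
  have hIeq : ENNReal.ofReal (∫ r in Ioc 0 T, r ^ 2 * f r ^ 2 * deriv H r ^ 2) =
      ∫⁻ r in Ioc 0 T, ENNReal.ofReal (r ^ 2 * f r ^ 2 * deriv H r ^ 2) :=
    ofReal_integral_eq_lintegral_ofReal hIint (Eventually.of_forall fun r => by positivity)
  have hI1 : ∫⁻ r in Ioc 0 R, ENNReal.ofReal (r ^ 2 * f r ^ 2 * deriv H r ^ 2) = 0 := by
    rw [setLIntegral_congr_fun measurableSet_Ioc (g := fun _ => 0) fun r hr => ?_, lintegral_zero]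
    rw [hH'0 r hr.2]; simp
  have hI2 : ∫⁻ r in Ioc R (R + θ₁), ENNReal.ofReal (r ^ 2 * f r ^ 2 * deriv H r ^ 2) ≤
      ENNReal.ofReal ((R + 1) ^ 2 * C_H ^ 2 * θ₁) := by
    calc ∫⁻ r in Ioc R (R + θ₁), ENNReal.ofReal (r ^ 2 * f r ^ 2 * deriv H r ^ 2)
        ≤ ∫⁻ r in Ioc R (R + θ₁), ENNReal.ofReal (r ^ 2 * deriv H r ^ 2) := by
          refine lintegral_mono fun r => ENNReal.ofReal_le_ofReal ?_
          have hf2 : f r ^ 2 ≤ 1 := pow_le_one₀ (hf0 r).le (hf1 r)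
          have h0 : 0 ≤ r ^ 2 * deriv H r ^ 2 := by positivity
          calc r ^ 2 * f r ^ 2 * deriv H r ^ 2 = (r ^ 2 * deriv H r ^ 2) * f r ^ 2 := by ring
            _ ≤ (r ^ 2 * deriv H r ^ 2) * 1 := mul_le_mul_of_nonneg_left hf2 h0
            _ = r ^ 2 * deriv H r ^ 2 := mul_one _
      _ ≤ _ := layer_lintegral_le hR.le hθ₁0 hθ₁1 hH'C
  have hIsum : ∫⁻ r in Ioc 0 T, ENNReal.ofReal (r ^ 2 * f r ^ 2 * deriv H r ^ 2) ≤
      ENNReal.ofReal ((R + 1) ^ 2 * C_H ^ 2 * θ₁) + ENNReal.ofReal B := by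
    rw [lintegral_Ioc_eq_add hR.le (by linarith) _, lintegral_Ioc_eq_add (by linarith) hRT _, hI1,
      zero_add]
    exact add_le_add hI2 hmain
  have hbdry : T ^ 2 * deriv f T * (f T * H T ^ 2) ≤ a₂ := by
    rw [hfT]
    obtain ⟨hH0, hH1⟩ := hH01 T
    have hk1 : f T * H T ^ 2 ≤ 1 := mul_le_one₀ (hf1 T) (sq_nonneg _) (pow_le_one₀ hH0 hH1)
    have hk0 : 0 ≤ f T * H T ^ 2 := mul_nonneg (hf0 T).le (sq_nonneg _)
    nlinarith
  rw [lintegral_Ioc_rayDensity hw hM hM0 hG₁c T, hid]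
  calc ENNReal.ofReal (T ^ 2 * deriv f T * (f T * H T ^ 2) + ∫ r in Ioc 0 T, r ^ 2 * f r ^ 2 * deriv H r ^ 2)
      ≤ ENNReal.ofReal (a₂ + ∫ r in Ioc 0 T, r ^ 2 * f r ^ 2 * deriv H r ^ 2) :=
        ENNReal.ofReal_le_ofReal (by linarith)
    _ = ENNReal.ofReal a₂ + ∫⁻ r in Ioc 0 T, ENNReal.ofReal (r ^ 2 * f r ^ 2 * deriv H r ^ 2) := by
        rw [ENNReal.ofReal_add ha₂0 hInn, hIeq]
    _ ≤ _ := add_le_add le_rfl hIsum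

end General

/-! ### Locality of the Volterra equation; flat cores; monotone profiles -/

section Locality

variable {w w₁ w₂ : ℝ → ℝ≥0∞} {M R ρ : ℝ}

/-- The Picard iterates on `[0, ρ]` only see the potential on `(0, ρ]`. [cite: LSSY2005, (2.4)] -/
theorem radialIter_congr_Iic (h : ∀ s, 0 < s → s ≤ ρ → w₁ s = w₂ s) :
    ∀ (k : ℕ) (r : ℝ), r ≤ ρ → radialIter w₁ k r = radialIter w₂ k r
  | 0, _, _ => rfl
  | k + 1, r, hr => by
    rw [radialIter_succ, radialIter_succ]
    congr 1
    refine setLIntegral_congr_fun measurableSet_Ioc fun s hs => ?_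
    rw [h s hs.1 (hs.2.trans hr), radialIter_congr_Iic h k s (hs.2.trans hr)]

/-- `u` on `[0, ρ]` only sees the potential on `(0, ρ]`. [cite: LSSY2005, (2.4)] -/
theorem radialSol_congr_Iic (h : ∀ s, 0 < s → s ≤ ρ → w₁ s = w₂ s) {r : ℝ} (hr : r ≤ ρ) :
    radialSol w₁ r = radialSol w₂ r := by
  simp only [radialSol, radialSolE, radialIter_congr_Iic h _ r hr]

/-- `u'` on `[0, ρ]` only sees the potential on `(0, ρ]`. [cite: LSSY2005, (2.4)–(2.5)] -/
theorem radialSolDeriv_congr_Iic (h : ∀ s, 0 < s → s ≤ ρ → w₁ s = w₂ s) {r : ℝ} (hr : r ≤ ρ) :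
    radialSolDeriv w₁ r = radialSolDeriv w₂ r := by
  simp only [radialSolDeriv]
  congr 2
  refine setLIntegral_congr_fun measurableSet_Ioc fun s hs => ?_
  rw [h s hs.1 (hs.2.trans hr)]
  simp only [radialSolE, radialIter_congr_Iic h _ s (hs.2.trans hr)]

/-- **A flat core**: if `w = 0` on `(0, ρ]` then `u(r) = r` and `u'(r) = 1` for `0 ≤ r ≤ ρ`.
[cite: LSSY2005, (2.4)–(2.5); FournaisSolovej2022, Lemma 3.2, proof ("φ_T is constant on {|x| ≤ R_T}")] -/
theorem radialSol_eq_self_of_core (hw : Measurable w) (hM : ∀ r, w r ≤ ENNReal.ofReal M) (hM0 : 0 ≤ M)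
    (h0 : ∀ s, 0 < s → s ≤ ρ → w s = 0) {r : ℝ} (hr0 : 0 ≤ r) (hr : r ≤ ρ) :
    radialSol w r = r ∧ radialSolDeriv w r = 1 := by
  have hint : ∀ F : ℝ → ℝ, ∫ s in Ioc 0 r, F s * ((w s).toReal / 2) * radialSol w s = 0 := fun F =>
    setIntegral_eq_zero_of_forall_eq_zero fun s hs => by rw [h0 s hs.1 (hs.2.trans hr)]; simp
  constructor
  · rw [radialSol_eq hw hM hM0 hr0, hint, add_zero]
  · rw [radialSolDeriv_eq hw hM hM0]
    have := hint fun _ => 1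
    simp only [one_mul] at this
    have h2 : ∫ s in Ioc 0 r, (w s).toReal / 2 * radialSol w s = 0 :=
      setIntegral_eq_zero_of_forall_eq_zero fun s hs => by rw [h0 s hs.1 (hs.2.trans hr)]; simp
    rw [h2, add_zero]

/-- **The profile is non-decreasing on `[0, ∞)`** (`f' = (ru' - u)/(u'(R)r²) ≥ 0`).
[cite: LSSY2005, App. C, Thm. C.1 ("f non-decreasing"); FournaisSolovej2022, §3.1] -/
theorem monotoneOn_radialProfile (hw : Measurable w) (hM : ∀ r, w r ≤ ENNReal.ofReal M) (hM0 : 0 ≤ M)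
    (R : ℝ) : MonotoneOn (radialProfile w R) (Ici 0) := by
  have hfc : ContDiff ℝ 1 (radialProfile w R) := contDiff_radialProfile hw hM hM0
  have hc := slope_pos hw hM hM0 R
  refine monotoneOn_of_deriv_nonneg (convex_Ici 0) hfc.continuous.continuousOn
    (hfc.differentiable one_ne_zero).differentiableOn fun r hr => ?_
  rw [interior_Ici] at hr
  have hr0 : 0 < r := hr
  rw [(hasDerivAt_radialProfile hw hM hM0 R hr0).deriv]
  exact div_nonneg (mul_deriv_sub_sol_bounds hw hM hM0 hr0.le).1 (by positivity)

/-- **The profile at the edge of the support**: `f(ρ) = 1 - a/ρ` already at `r = ρ` if `w = 0`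
beyond `ρ` (`0 < ρ ≤ R`; by continuity from `f = 1 - a/r` on `(ρ, ∞)`).
[cite: LSSY2005, App. C, Thm. C.1 (C.7)] -/
theorem radialProfile_eq_one_sub_div_self (hw : Measurable w) (hM : ∀ r, w r ≤ ENNReal.ofReal M)
    (hM0 : 0 ≤ M) (hρ : 0 < ρ) (hρR : ρ ≤ R) (hwρ : ∀ s, ρ < s → w s = 0) :
    radialProfile w R ρ = 1 - odeScatteringLength w R / ρ := by
  have hfc : Continuous (radialProfile w R) := (contDiff_radialProfile hw hM hM0).continuous
  have h1 : Tendsto (radialProfile w R) (𝓝[>] ρ) (𝓝 (radialProfile w R ρ)) :=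
    hfc.continuousAt.tendsto.mono_left nhdsWithin_le_nhds
  have h2 : Tendsto (fun r => 1 - odeScatteringLength w R / r) (𝓝[>] ρ)
      (𝓝 (1 - odeScatteringLength w R / ρ)) := by
    have : ContinuousAt (fun r : ℝ => 1 - odeScatteringLength w R / r) ρ :=
      continuousAt_const.sub (continuousAt_const.div continuousAt_id hρ.ne')
    exact this.tendsto.mono_left nhdsWithin_le_nhds
  have heq : (radialProfile w R) =ᶠ[𝓝[>] ρ] fun r => 1 - odeScatteringLength w R / r := by
    filter_upwards [self_mem_nhdsWithin] with r hr
    exact radialProfile_eq_one_sub_div hw hM hM0 hρ.le hρR hwρ hr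
  exact tendsto_nhds_unique (h1.congr' heq) h2

end Locality

/-! ### The tail mass `m(ρ) = ∫_ρ^{R₀} ½ w s²` and the bound `f(ρ) m(ρ) ≤ a` -/

section TailMass

variable {w : ℝ → ℝ≥0∞} {M R₀ : ℝ}

/-- The tail-mass integrand `½ w(s) s²` is integrable on bounded intervals. [folklore] -/
theorem integrableOn_half_pot_sq (hw : Measurable w) (hM : ∀ r, w r ≤ ENNReal.ofReal M) (hM0 : 0 ≤ M)
    (a b : ℝ) : IntegrableOn (fun s => (w s).toReal / 2 * s ^ 2) (Ioc a b) := by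
  refine integrableOn_Ioc_of_bound (C := M / 2 * max (a ^ 2) (b ^ 2))
    ((hw.ennreal_toReal.div_const 2).mul (measurable_id.pow_const 2)) fun s hs => ?_
  have hW0 : 0 ≤ (w s).toReal := ENNReal.toReal_nonneg
  have hW : (w s).toReal ≤ M := toReal_pot_le hM hM0 s
  rw [abs_of_nonneg (by positivity)]
  have hs2 : s ^ 2 ≤ max (a ^ 2) (b ^ 2) := by
    rcases le_or_gt 0 s with h | h
    · exact (pow_le_pow_left₀ h hs.2 2).trans (le_max_right _ _)
    · have : s ^ 2 ≤ a ^ 2 := by nlinarith [hs.1]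
      exact this.trans (le_max_left _ _)
  exact mul_le_mul (by linarith) hs2 (sq_nonneg _) (by positivity)

/-- The tail mass is continuous in the cut radius. [folklore] -/
theorem continuous_tailMass (hw : Measurable w) (hM : ∀ r, w r ≤ ENNReal.ofReal M) (hM0 : 0 ≤ M)
    (R₀ : ℝ) : Continuous fun ρ => ∫ s in ρ..R₀, (w s).toReal / 2 * s ^ 2 := by
  have hint : ∀ a b : ℝ, IntervalIntegrable (fun s => (w s).toReal / 2 * s ^ 2) volume a b := by
    intro a b
    rw [intervalIntegrable_iff]
    rcases le_or_gt a b with h | h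
    · rw [uIoc_of_le h]; exact integrableOn_half_pot_sq hw hM hM0 a b
    · rw [uIoc_of_ge h.le]; exact integrableOn_half_pot_sq hw hM hM0 b a
  have h := intervalIntegral.continuous_primitive hint R₀
  have heq : (fun ρ => ∫ s in ρ..R₀, (w s).toReal / 2 * s ^ 2) =
      fun ρ => -∫ s in R₀..ρ, (w s).toReal / 2 * s ^ 2 := by
    funext ρ; rw [intervalIntegral.integral_symm]
  rw [heq]
  exact h.neg

/-- **Intermediate radii**: every value in `(0, m(0))` of the tail mass is attained at some
`0 < ρ < R₀` (continuity). [cite: FournaisSolovej2022, Lemma 3.2, proof (definition of R_T, (3.16))] -/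
theorem exists_tailMass_eq (hw : Measurable w) (hM : ∀ r, w r ≤ ENNReal.ofReal M) (hM0 : 0 ≤ M)
    (hR₀ : 0 < R₀) {t : ℝ} (ht0 : 0 < t) (ht : t < ∫ s in Ioc 0 R₀, (w s).toReal / 2 * s ^ 2) :
    ∃ ρ, 0 < ρ ∧ ρ < R₀ ∧ ∫ s in Ioc ρ R₀, (w s).toReal / 2 * s ^ 2 = t := by
  set m : ℝ → ℝ := fun ρ => ∫ s in ρ..R₀, (w s).toReal / 2 * s ^ 2 with hm
  have hmc : Continuous m := continuous_tailMass hw hM hM0 R₀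
  have hm0 : m 0 = ∫ s in Ioc 0 R₀, (w s).toReal / 2 * s ^ 2 := intervalIntegral.integral_of_le hR₀.le
  have hmR : m R₀ = 0 := intervalIntegral.integral_same
  have hmem : t ∈ Icc (m R₀) (m 0) := ⟨by rw [hmR]; exact ht0.le, by rw [hm0]; exact ht.le⟩
  obtain ⟨ρ, hρ, hρt⟩ := intermediate_value_Icc' hR₀.le hmc.continuousOn hmem
  have hρ0 : ρ ≠ 0 := by rintro rfl; rw [hm0] at hρt; linarith
  have hρR : ρ ≠ R₀ := by rintro rfl; rw [hmR] at hρt; linarith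
  refine ⟨ρ, lt_of_le_of_ne hρ.1 (Ne.symm hρ0), lt_of_le_of_ne hρ.2 hρR, ?_⟩
  rw [← intervalIntegral.integral_of_le hρ.2]
  exact hρt

/-- **`f(ρ)·m(ρ) ≤ a`**: `a = ∫₀^{R₀} ½ws²f ≥ ∫_ρ^{R₀} ½ws²f ≥ f(ρ)∫_ρ^{R₀} ½ws²` since the profile is
non-decreasing; with `∫ w_S = 8πSa` this is FS's `φ_S(R_S) ≤ a_S/(aS)` and `φ(R_S) ≤ 1/S`.
[cite: FournaisSolovej2022, Lemma 3.2, proof, (3.17)–(3.19)] -/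
theorem radialProfile_mul_tailMass_le (hw : Measurable w) (hM : ∀ r, w r ≤ ENNReal.ofReal M) (hM0 : 0 ≤ M)
    (hR₀ : 0 < R₀) (hwR₀ : ∀ s, R₀ < s → w s = 0) {ρ : ℝ} (hρ : 0 ≤ ρ) :
    radialProfile w R₀ ρ * ∫ s in Ioc ρ R₀, (w s).toReal / 2 * s ^ 2 ≤ odeScatteringLength w R₀ := by
  set f := radialProfile w R₀ with hf
  have hfc : Continuous f := (contDiff_radialProfile hw hM hM0).continuous
  have hmono := monotoneOn_radialProfile hw hM hM0 R₀
  rw [← integral_pot_sq_profile hw hM hM0 hR₀ hwR₀, ← integral_const_mul]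
  have hi0 : IntegrableOn (fun s => (w s).toReal / 2 * s ^ 2 * f s) (Ioc 0 R₀) :=
    (integrableOn_half_pot_sq hw hM hM0 0 R₀).mul_continuousOn_of_subset hfc.continuousOn
      measurableSet_Ioc isCompact_Icc Ioc_subset_Icc_self
  have hnn : ∀ s ∈ Ioc 0 R₀, 0 ≤ (w s).toReal / 2 * s ^ 2 * f s := fun s _ =>
    mul_nonneg (by positivity) (radialProfile_pos hw hM hM0 R₀ s).le
  calc ∫ s in Ioc ρ R₀, f ρ * ((w s).toReal / 2 * s ^ 2)
      ≤ ∫ s in Ioc ρ R₀, (w s).toReal / 2 * s ^ 2 * f s := by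
        refine setIntegral_mono_on ((integrableOn_half_pot_sq hw hM hM0 ρ R₀).const_mul _)
          (hi0.mono_set (Ioc_subset_Ioc_left hρ)) measurableSet_Ioc fun s hs => ?_
        have hfs : f ρ ≤ f s := hmono (mem_Ici.2 hρ) (mem_Ici.2 (hρ.trans hs.1.le)) hs.1.le
        have h0 : 0 ≤ (w s).toReal / 2 * s ^ 2 := by positivity
        nlinarith
    _ ≤ ∫ s in Ioc 0 R₀, (w s).toReal / 2 * s ^ 2 * f s :=
        setIntegral_mono_set hi0 (Eventually.of_forall fun s => mul_nonneg (by positivity)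
          (radialProfile_pos hw hM hM0 R₀ s).le) (Ioc_subset_Ioc_left hρ).eventuallyLE

end TailMass

/-! ### The first regime: cutting out the core costs at most `R_S φ_S(R_S)` -/

section Regime1

variable {w : ℝ → ℝ≥0∞} {M R₀ ρ : ℝ}

/-- **Cutting out the core of a bounded potential lowers the scattering length by at most
`R_S·φ_S(R_S)`**: for `0 < ρ < R₀` and the tail `w_S = w·1_{(ρ,∞)}` with profile `φ_S`
(`= φ_S(ρ)` constant on the flat core), `a(w) ≤ a(w_S) + ρ φ_S(ρ)`. This is the first regime of
[FournaisSolovej2022, Lemma 3.2]: the trial state `u = 1_{r ≥ ρ}(φ_S - c/r)`, `c = ρφ_S(ρ)`, in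
the functional of `w` (`= w_S` off the core); FS bound the error `E₃` by `c²(ρ⁻¹ + ρ⁻²∫w_S/8π)`,
here (product form `φ_S h`, `h = 1 - ρ/u_S`) by `(ρ²/C₀)∫u_S'/u_S² ≤ c`.
[cite: FournaisSolovej2022, Lemma 3.2, proof, (3.20)–(3.22); FournaisEtAl2024, Lemma 3.4] -/
theorem odeScatteringLength_le_tail_add (hw : Measurable w) (hM : ∀ r, w r ≤ ENNReal.ofReal M)
    (hM0 : 0 ≤ M) (hR₀ : 0 < R₀) (hwR₀ : ∀ s, R₀ < s → w s = 0) (hρ : 0 < ρ) (hρR : ρ < R₀) :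
    odeScatteringLength w R₀ ≤ odeScatteringLength ((Ioi ρ).indicator w) R₀ +
      ρ * radialProfile ((Ioi ρ).indicator w) R₀ ρ := by
  -- the tail potential
  set wS : ℝ → ℝ≥0∞ := (Ioi ρ).indicator w with hwS
  have hmS : Measurable wS := hw.indicator measurableSet_Ioi
  have hbS : ∀ r, wS r ≤ ENNReal.ofReal M := fun r => by
    rw [hwS]; by_cases h : r ∈ Ioi ρ
    · rw [indicator_of_mem h]; exact hM r
    · rw [indicator_of_notMem h]; exact zero_le
  have hSR₀ : ∀ s, R₀ < s → wS s = 0 := fun s hs => by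
    rw [hwS]; by_cases h : s ∈ Ioi ρ
    · rw [indicator_of_mem h]; exact hwR₀ s hs
    · exact indicator_of_notMem h _
  have hS0 : ∀ s, 0 < s → s ≤ ρ → wS s = 0 := fun s _ hs => indicator_of_notMem (not_lt.2 hs) _
  have hSw : ∀ s, ρ < s → wS s = w s := fun s hs => indicator_of_mem (mem_Ioi.2 hs) _
  -- the radial solution of the tail, its slope `C₀` and profile `f_S`
  obtain ⟨uS, huS⟩ : ∃ u : ℝ → ℝ, u = radialSol wS := ⟨_, rfl⟩
  set C₀ : ℝ := radialSolDeriv wS R₀ with hC₀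
  have hC₀pos : 0 < C₀ := slope_pos hmS hbS hM0 R₀
  set aS : ℝ := odeScatteringLength wS R₀ with haS
  have haS0 : 0 ≤ aS := odeScatteringLength_nonneg hmS hbS hM0 hR₀.le
  have haSR : aS < R₀ := odeScatteringLength_lt hmS hbS hM0 hR₀
  obtain ⟨fS, hfS⟩ : ∃ f : ℝ → ℝ, f = radialProfile wS R₀ := ⟨_, rfl⟩
  have hfSc : ContDiff ℝ 1 fS := hfS ▸ contDiff_radialProfile hmS hbS hM0
  have hfS0 : ∀ r, 0 < fS r := fun r => hfS ▸ radialProfile_pos hmS hbS hM0 R₀ r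
  have hfS1 : ∀ r, fS r ≤ 1 := fun r => hfS ▸ radialProfile_le_one hmS hbS hM0 hR₀ hSR₀ r
  have hfS_far : ∀ r, R₀ < r → fS r = 1 - aS / r := fun r hr =>
    hfS ▸ radialProfile_eq_one_sub_div hmS hbS hM0 hR₀.le le_rfl hSR₀ hr
  have hfS'_far : ∀ r, R₀ ≤ r → deriv fS r = aS / r ^ 2 := fun r hr =>
    hfS ▸ deriv_radialProfile_of_ge hmS hbS hM0 hR₀ hSR₀ hr
  have hfST : ∀ T, R₀ ≤ T → T ^ 2 * deriv fS T = aS := fun T hT =>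
    hfS ▸ sq_mul_deriv_radialProfile hmS hbS hM0 hR₀ hSR₀ hT
  -- `u_S`: flat core, positivity, monotonicity, derivative, the linear tail
  have hu_core : ∀ r, 0 ≤ r → r ≤ ρ → uS r = r := fun r h0 h1 =>
    huS ▸ (radialSol_eq_self_of_core hmS hbS hM0 hS0 h0 h1).1
  have huρ : uS ρ = ρ := hu_core ρ hρ.le le_rfl
  have hu_pos : ∀ r, 0 < r → 0 < uS r := fun r hr => huS ▸ radialSol_pos hmS hbS hM0 hr
  have hu_mono : ∀ r₁ r₂, 0 ≤ r₁ → r₁ ≤ r₂ → uS r₁ ≤ uS r₂ := fun r₁ r₂ h1 h2 =>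
    huS ▸ radialSol_mono hmS hbS hM0 h1 h2
  have hu_ge : ∀ r, ρ ≤ r → ρ ≤ uS r := fun r hr => huρ ▸ hu_mono ρ r hρ.le hr
  have hu_deriv : ∀ r, 0 < r → HasDerivAt uS (radialSolDeriv wS r) r := fun r hr =>
    huS ▸ hasDerivAt_radialSol hmS hbS hM0 hr
  have hu'_le : ∀ r, radialSolDeriv wS r ≤ C₀ := fun r => by
    rcases le_or_gt r R₀ with h | h
    · exact monotone_radialSolDeriv hmS hbS hM0 h
    · rw [hC₀, ← radialSolDeriv_eq_of_ge hmS hbS hM0 hR₀.le hSR₀ h.le]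
  have hu'_nn : ∀ r, 0 ≤ radialSolDeriv wS r := fun r => (radialSolDeriv_pos hmS hbS hM0 r).le
  have hu_far : ∀ r, R₀ ≤ r → uS r = C₀ * (r - aS) := by
    intro r hr
    rw [huS, radialSol_eq_of_ge hmS hbS hM0 hR₀.le hSR₀ hr, haS, odeScatteringLength, ← hC₀]
    field_simp
    ring
  have hrfS : ∀ r, 0 < r → r * fS r = uS r / C₀ := by
    intro r hr
    rw [hfS, radialProfile_of_pos wS R₀ hr, huS, ← hC₀]
    field_simp
  have hfSρ : fS ρ = C₀⁻¹ := by
    have h := hrfS ρ hρ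
    rw [huρ] at h
    field_simp at h ⊢
    linarith
  -- the constant `c = ρ f_S(ρ) = ρ/C₀`
  set c : ℝ := ρ * fS ρ with hc
  have hcC : c = ρ / C₀ := by rw [hc, hfSρ, div_eq_mul_inv]
  have hc0 : 0 < c := by rw [hc]; exact mul_pos hρ (hfS0 ρ)
  -- the comparison function `h = 1 - ρ/u_S`, globalised through a smooth floor
  set q : ℝ → ℝ := glue (ρ / 2) (ρ / 4) (fun _ => ρ / 2) id with hq
  have hqc : ContDiff ℝ 1 q := glue_contDiff contDiff_const contDiff_id _ _
  have hq_ge : ∀ r, ρ / 2 ≤ q r := le_glue_const_id (by linarith) (ρ / 2)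
  have hq_pos : ∀ r, 0 < q r := fun r => by linarith [hq_ge r]
  have hq_id : ∀ r, 3 * ρ / 4 ≤ r → q r = r := fun r hr => glue_of_ge (by linarith) (by linarith)
  have hqd : ∀ r, HasDerivAt q (deriv q r) r := fun r => (hqc.differentiable one_ne_zero r).hasDerivAt
  obtain ⟨G, hG⟩ : ∃ G : ℝ → ℝ, G = fun r => uS (q r) := ⟨_, rfl⟩
  have hGd : ∀ r, HasDerivAt G (radialSolDeriv wS (q r) * deriv q r) r := fun r => by
    rw [hG]; exact (hu_deriv (q r) (hq_pos r)).comp r (hqd r)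
  have hGc : ContDiff ℝ 1 G := by
    refine contDiff_one_iff_deriv.2 ⟨fun r => (hGd r).differentiableAt, ?_⟩
    have heq : deriv G = fun r => radialSolDeriv wS (q r) * deriv q r := funext fun r => (hGd r).deriv
    rw [heq]
    exact ((continuous_radialSolDeriv hmS hbS hM0).comp hqc.continuous).mul (hqc.continuous_deriv le_rfl)
  have hG_pos : ∀ r, 0 < G r := fun r => by rw [hG]; exact hu_pos _ (hq_pos r)
  obtain ⟨hh, hh_def⟩ : ∃ hh : ℝ → ℝ, hh = fun r => 1 - ρ * (G r)⁻¹ := ⟨_, rfl⟩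
  have hhc : ContDiff ℝ 1 hh :=
    hh_def ▸ contDiff_const.sub (contDiff_const.mul (hGc.inv fun r => (hG_pos r).ne'))
  have hh_eq : ∀ r, 3 * ρ / 4 ≤ r → hh r = 1 - ρ / uS r := fun r hr => by
    rw [hh_def, hG]; dsimp only; rw [hq_id r hr, div_eq_mul_inv]
  have hh_ρ : hh ρ = 0 := by rw [hh_eq ρ (by linarith), huρ, div_self hρ.ne', sub_self]
  have hh_mem : ∀ r, ρ ≤ r → 0 ≤ hh r ∧ hh r ≤ 1 := by
    intro r hr
    have hu := hu_ge r hr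
    have hu0 : 0 < uS r := hρ.trans_le hu
    rw [hh_eq r (by linarith)]
    constructor
    · rw [sub_nonneg, div_le_one hu0]; exact hu
    · have : 0 ≤ ρ / uS r := div_nonneg hρ.le hu0.le
      linarith
  have hh_deriv : ∀ r, 3 * ρ / 4 < r → deriv hh r = ρ * radialSolDeriv wS r / uS r ^ 2 := by
    intro r hr
    have hr0 : 0 < r := by linarith
    have hu0 : uS r ≠ 0 := (hu_pos r hr0).ne'
    have hev : hh =ᶠ[𝓝 r] fun r => 1 - ρ * (uS r)⁻¹ := by
      filter_upwards [Ioi_mem_nhds hr] with s hs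
      rw [hh_eq s (le_of_lt hs), div_eq_mul_inv]
    rw [hev.deriv_eq]
    have hd : HasDerivAt (fun r => 1 - ρ * (uS r)⁻¹) _ r :=
      (((hu_deriv r hr0).inv hu0).const_mul ρ).const_sub 1
    rw [hd.deriv]
    field_simp
  have hh_far : ∀ r, R₀ ≤ r → hh r = 1 - c / (r - aS) := by
    intro r hr
    have hraS : r - aS ≠ 0 := by linarith
    rw [hh_eq r (by linarith), hu_far r hr, hcC]
    field_simp
  have hh_one_sub_far : ∀ r, R₀ ≤ r → 1 - hh r = (aS + c - aS) / (r - aS) := fun r hr => by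
    rw [hh_far r hr]; ring
  have hh_deriv_far : ∀ r, R₀ ≤ r → deriv hh r = (aS + c - aS) / (r - aS) ^ 2 := by
    intro r hr
    have hraS : r - aS ≠ 0 := by linarith
    rw [hh_deriv r (by linarith), hu_far r hr, hcC,
      radialSolDeriv_eq_of_ge hmS hbS hM0 hR₀.le hSR₀ hr, ← hC₀]
    field_simp
    ring
  -- constants
  obtain ⟨Mχ, hMχ0, hMχ⟩ := exists_bound_deriv_smoothTransition
  obtain ⟨C_H, hCH0, hCH⟩ := exists_deriv_glue_bound (contDiff_const (c := (0 : ℝ))) hhc ρ (ρ + 1)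
  set D : ℝ := (aS + 4 * (aS + c)) + Mχ * (aS + 2 * (aS + c)) with hD
  have hD0 : 0 ≤ D := by rw [hD]; positivity
  -- it suffices to bound the variational scattering length of `w`
  have haw : scatteringLength w = ENNReal.ofReal (odeScatteringLength w R₀) :=
    scatteringLength_eq_ofReal_odeScatteringLength hw hM hM0 hR₀ hwR₀
  suffices hmain : scatteringLength w ≤ ENNReal.ofReal (aS + c) by
    rw [haw] at hmain
    rw [show ρ * radialProfile wS R₀ ρ = c by rw [hc, hfS]]
    exact (ENNReal.ofReal_le_ofReal_iff (by positivity)).1 hmain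
  refine ENNReal.le_of_forall_pos_le_add fun ε hε _ => ?_
  have hε0 : (0 : ℝ) < ε := NNReal.coe_pos.2 hε
  obtain ⟨θ₁, hθ₁0, hθ₁1, hθ₁E⟩ := exists_theta₁ (R := ρ) (C := C_H) (ε₁ := 2 * ε) (by positivity)
  set T : ℝ := max (max (R₀ + 1) (2 * (aS + c))) (8 * D ^ 2 / ε + 1) with hT_def
  have hT1 : R₀ + 1 ≤ T := (le_max_left _ _).trans (le_max_left _ _)
  have hT2 : 2 * (aS + c) ≤ T := (le_max_right _ _).trans (le_max_left _ _)
  have hT3 : 8 * D ^ 2 / ε < T := by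
    have : 8 * D ^ 2 / ε + 1 ≤ T := le_max_right _ _
    linarith
  have hT0 : 0 < T := by linarith
  have hρT : ρ + θ₁ ≤ T := by linarith
  have hR₀T : R₀ < T := by linarith
  have hlayerE : 4 * T ^ 3 * (D / T ^ 2) ^ 2 ≤ ε / 2 := by
    have h1 : 4 * T ^ 3 * (D / T ^ 2) ^ 2 = 4 * D ^ 2 / T := by field_simp
    rw [h1, div_le_iff₀ hT0]
    have h2 : 8 * D ^ 2 < T * ε := by rwa [div_lt_iff₀ hε0] at hT3
    nlinarith
  -- `H = glue_ρ[0, h]`, `g = glue_T[f_S H, 1]`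
  obtain ⟨H, hH_def⟩ : ∃ H : ℝ → ℝ, H = glue ρ θ₁ (fun _ => (0 : ℝ)) hh := ⟨_, rfl⟩
  have hHc : ContDiff ℝ 1 H := hH_def ▸ glue_contDiff contDiff_const hhc _ _
  have hH_le : ∀ r, r ≤ ρ → H r = 0 := fun r hr => by rw [hH_def, glue_of_le hθ₁0 hr]
  have hH_ge : ∀ r, ρ + θ₁ ≤ r → H r = hh r := fun r hr => by rw [hH_def, glue_of_ge hθ₁0 hr]
  have hH'_le : ∀ r, r ≤ ρ → deriv H r = 0 := fun r hr => by
    rw [hH_def, deriv_glue_of_le contDiff_const hhc hθ₁0 hr]; exact deriv_const r 0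
  have hH'_ge : ∀ r, ρ + θ₁ ≤ r → deriv H r = deriv hh r := fun r hr => by
    rw [hH_def, deriv_glue_of_ge contDiff_const hhc hθ₁0 hr]
  have hH_mem : ∀ r, 0 ≤ H r ∧ H r ≤ 1 := by
    intro r
    rcases le_or_gt r ρ with hr | hr
    · rw [hH_le r hr]; exact ⟨le_rfl, zero_le_one⟩
    · obtain ⟨h0, h1⟩ := hh_mem r hr.le
      have hχ0 := smoothStep_nonneg (r₀ := ρ) (θ := θ₁) r
      have hχ1 := smoothStep_le_one (r₀ := ρ) (θ := θ₁) r
      rw [hH_def, glue_eq_add]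
      simp only [sub_zero, zero_add]
      exact ⟨mul_nonneg hχ0 h0, mul_le_one₀ hχ1 h0 h1⟩
  have hCH' : ∀ r ∈ Icc ρ (ρ + θ₁), |deriv H r| ≤ C_H := by
    rw [hH_def]
    exact hCH ρ θ₁ hθ₁0 hθ₁1 le_rfl (by linarith) (Or.inl hh_ρ.symm)
  obtain ⟨g, hg_def⟩ : ∃ g : ℝ → ℝ, g = glue T T (fun r => fS r * H r) fun _ => (1 : ℝ) := ⟨_, rfl⟩
  have hG₁c : ContDiff ℝ 1 fun r => fS r * H r := hfSc.mul hHc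
  have hgc : ContDiff ℝ 1 g := hg_def ▸ glue_contDiff hG₁c contDiff_const _ _
  have hg_le : ∀ r, r ≤ T → g r = fS r * H r := fun r hr => by rw [hg_def, glue_of_le hT0 hr]
  have hg'_le : ∀ r, r ≤ T → deriv g r = deriv (fun r => fS r * H r) r := fun r hr => by
    rw [hg_def, deriv_glue_of_le hG₁c contDiff_const hT0 hr]
  have hg_ge : ∀ r, 2 * T ≤ r → g r = 1 := fun r hr => by
    rw [hg_def, glue_of_ge hT0 (by linarith)]
  have hg'_ge : ∀ r, 2 * T ≤ r → deriv g r = 0 := fun r hr => by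
    rw [hg_def, deriv_glue_of_ge hG₁c contDiff_const hT0 (by linarith)]; exact deriv_const r 1
  have hg0 : ∀ r, r ≤ ρ → g r = 0 := fun r hr => by
    rw [hg_le r (by linarith), hH_le r hr, mul_zero]
  -- the trial function
  have hφc : ContDiff ℝ 1 (radialFun g) :=
    radialFun_contDiff hgc hρ fun r hr => by rw [hg0 r hr, hg0 0 hρ.le]
  have hφt : IsScatteringTrial (radialFun g) := by
    refine ⟨hφc, HasCompactSupport.intro (isCompact_closedBall (0 : Space) (2 * T)) fun x hx => ?_⟩
    rw [mem_closedBall, dist_zero_right, not_le] at hx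
    simp only [radialFun, hg_ge _ hx.le, sub_self]
  have hpot : scatteringFunctional w (radialFun g) = scatteringFunctional wS (radialFun g) := by
    refine lintegral_congr fun x => ?_
    by_cases hx : ‖x‖ ≤ ρ
    · simp [radialFun, hg0 _ hx]
    · rw [hSw _ (lt_of_not_ge hx)]
  have h4 : ENNReal.ofReal (4 * Real.pi) ≠ 0 := by rw [ENNReal.ofReal_ne_zero_iff]; positivity
  -- (P1) the energy on `(0, T]`: the bulk term `∫ r² f_S² h'² ≤ c`
  have hbulk : ∫⁻ r in Ioc (ρ + θ₁) T, ENNReal.ofReal (r ^ 2 * fS r ^ 2 * deriv H r ^ 2) ≤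
      ENNReal.ofReal c := by
    have hα0 : 0 < ρ + θ₁ := by linarith
    -- pointwise: `r² f_S² h'² ≤ (ρ²/C₀) u_S'/u_S²`
    have hpt : ∀ r ∈ Ioc (ρ + θ₁) T, r ^ 2 * fS r ^ 2 * deriv H r ^ 2 ≤
        ρ ^ 2 / C₀ * (radialSolDeriv wS r / uS r ^ 2) := by
      intro r hr
      have hr0 : 0 < r := hα0.trans hr.1
      have hu0 : 0 < uS r := hu_pos r hr0
      rw [hH'_ge r hr.1.le, hh_deriv r (by linarith [hr.1])]
      have h1 : r ^ 2 * fS r ^ 2 * (ρ * radialSolDeriv wS r / uS r ^ 2) ^ 2 =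
          ρ ^ 2 / C₀ * (radialSolDeriv wS r / uS r ^ 2) * (radialSolDeriv wS r / C₀) := by
        have : r * fS r = uS r / C₀ := hrfS r hr0
        have h' : r ^ 2 * fS r ^ 2 = (uS r / C₀) ^ 2 := by rw [← this]; ring
        rw [h']
        field_simp
      rw [h1]
      have h2 : radialSolDeriv wS r / C₀ ≤ 1 := (div_le_one hC₀pos).2 (hu'_le r)
      have h3 : 0 ≤ ρ ^ 2 / C₀ * (radialSolDeriv wS r / uS r ^ 2) := by
        have := hu'_nn r; positivity
      exact mul_le_of_le_one_right h3 h2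
    -- the primitive `-(ρ²/C₀)/u_S`
    have hFd : ∀ r, 0 < r → HasDerivAt (fun r => -(ρ ^ 2 / C₀) * (uS r)⁻¹)
        (ρ ^ 2 / C₀ * (radialSolDeriv wS r / uS r ^ 2)) r := by
      intro r hr
      have hu0 : uS r ≠ 0 := (hu_pos r hr).ne'
      refine (((hu_deriv r hr).inv hu0).const_mul _).congr_deriv ?_
      field_simp
    have hcont : ContinuousOn (fun r => ρ ^ 2 / C₀ * (radialSolDeriv wS r / uS r ^ 2)) (Icc (ρ + θ₁) T) := by
      refine continuousOn_of_forall_continuousAt fun r hr => ?_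
      have hr0 : 0 < r := hα0.trans_le hr.1
      have huc : ContinuousAt uS r := (hu_deriv r hr0).continuousAt
      exact continuousAt_const.mul (((continuous_radialSolDeriv hmS hbS hM0).continuousAt).div
        (huc.pow 2) (pow_ne_zero 2 (hu_pos r hr0).ne'))
    have hint : IntegrableOn (fun r => ρ ^ 2 / C₀ * (radialSolDeriv wS r / uS r ^ 2)) (Ioc (ρ + θ₁) T) :=
      hcont.integrableOn_Icc.mono_set Ioc_subset_Icc_self
    have hftc : ∫ r in Ioc (ρ + θ₁) T, ρ ^ 2 / C₀ * (radialSolDeriv wS r / uS r ^ 2) =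
        -(ρ ^ 2 / C₀) * (uS T)⁻¹ - -(ρ ^ 2 / C₀) * (uS (ρ + θ₁))⁻¹ := by
      rw [← intervalIntegral.integral_of_le hρT]
      refine intervalIntegral.integral_eq_sub_of_hasDerivAt (fun r hr => hFd r ?_)
        (hcont.intervalIntegrable_of_Icc hρT)
      rw [uIcc_of_le hρT] at hr
      exact hα0.trans_le hr.1
    calc ∫⁻ r in Ioc (ρ + θ₁) T, ENNReal.ofReal (r ^ 2 * fS r ^ 2 * deriv H r ^ 2)
        ≤ ∫⁻ r in Ioc (ρ + θ₁) T, ENNReal.ofReal (ρ ^ 2 / C₀ * (radialSolDeriv wS r / uS r ^ 2)) :=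
          setLIntegral_mono' measurableSet_Ioc fun r hr => ENNReal.ofReal_le_ofReal (hpt r hr)
      _ = ENNReal.ofReal (∫ r in Ioc (ρ + θ₁) T, ρ ^ 2 / C₀ * (radialSolDeriv wS r / uS r ^ 2)) := by
          rw [ofReal_integral_eq_lintegral_ofReal hint]
          filter_upwards [ae_restrict_mem measurableSet_Ioc] with r hr
          have := hu'_nn r
          have := hu_pos r (hα0.trans hr.1)
          positivity
      _ ≤ ENNReal.ofReal c := by
          refine ENNReal.ofReal_le_ofReal ?_
          rw [hftc, hcC]
          have huT : 0 < uS T := hu_pos T hT0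
          have huα : ρ ≤ uS (ρ + θ₁) := hu_ge _ (by linarith)
          have huα0 : 0 < uS (ρ + θ₁) := hρ.trans_le huα
          have h1 : 0 ≤ ρ ^ 2 / C₀ * (uS T)⁻¹ := by positivity
          have h2 : ρ ^ 2 / C₀ * (uS (ρ + θ₁))⁻¹ ≤ ρ ^ 2 / C₀ * ρ⁻¹ :=
            mul_le_mul_of_nonneg_left ((inv_le_inv₀ huα0 hρ).2 huα) (by positivity)
          have h3 : ρ ^ 2 / C₀ * ρ⁻¹ = ρ / C₀ := by field_simp
          linarith
  have hP1 : ∫⁻ r in Ioc 0 T, rayDensity wS g r ≤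
      ENNReal.ofReal aS + (ENNReal.ofReal ((ρ + 1) ^ 2 * C_H ^ 2 * θ₁) + ENNReal.ofReal c) := by
    have hcongr : ∫⁻ r in Ioc 0 T, rayDensity wS g r = ∫⁻ r in Ioc 0 T, rayDensity wS (fun r => fS r * H r) r := by
      refine setLIntegral_congr_fun measurableSet_Ioc fun r hr => ?_
      rw [rayDensity, rayDensity, hg_le r hr.2, hg'_le r hr.2]
    rw [hcongr]
    exact lintegral_rayDensity_profile_mul_le_of hmS hbS hM0 hρ hθ₁0 hθ₁1 hρT haS0 hfS hfS0 hfS1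
      (hfST T hR₀T.le) hHc hH_mem hH'_le hCH' hbulk
  -- (P2) the cut-off layer
  have hP2 : ∫⁻ r in Ioc T (2 * T), rayDensity wS g r ≤ ENNReal.ofReal (ε / 2) := by
    obtain ⟨hA, hB⟩ := cutoff_data_profile_mul (f := fS) (H := H) (R := aS + c) (aK := aS) (a₂ := aS)
      (by linarith) haS0 (by linarith) haS0 hT0 hT2 hfSc hHc hfS0 hfS1
      (fun r hr => hfS_far r (by linarith)) (fun r hr => hfS'_far r (by linarith))
      (fun r hr => by rw [hH_ge r (by linarith)]; exact hh_mem r (by linarith))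
      (fun r hr => by rw [hH_ge r (by linarith)]; exact hh_one_sub_far r (by linarith))
      (fun r hr => by rw [hH'_ge r (by linarith)]; exact hh_deriv_far r (by linarith))
    have hE : ∀ r ∈ Icc T (2 * T), |deriv g r| ≤ D / T ^ 2 := by
      intro r hr
      rw [hg_def, hD]
      exact abs_deriv_glue_cutoff_le hG₁c hT0 hMχ hMχ0 hA hB hr
    have hwT : ∀ r, T < r → wS r = 0 := fun r hr => hSR₀ r (by linarith)
    exact (lintegral_cutoff_layer_le hT0 hwT hE).trans (ENNReal.ofReal_le_ofReal hlayerE)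
  -- (P3) beyond `2T`
  have hP3 : ∫⁻ r in Ioi (2 * T), rayDensity wS g r = 0 := by
    rw [setLIntegral_congr_fun measurableSet_Ioi (g := fun _ => 0) fun r hr => ?_, lintegral_zero]
    have hr : 2 * T < r := hr
    rw [rayDensity_of_eq_zero (hSR₀ r (by linarith)), hg'_ge r hr.le]
    simp
  -- assembly
  have hθE : (ρ + 1) ^ 2 * C_H ^ 2 * θ₁ ≤ ε / 2 := by linarith
  calc scatteringLength w
      ≤ (ENNReal.ofReal (4 * Real.pi))⁻¹ * scatteringFunctional w (radialFun g) := scatteringLength_le hφt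
    _ = ∫⁻ r in Ioi 0, rayDensity wS g r := by
        rw [hpot, scatteringFunctional_radialFun hgc hmS, ← mul_assoc,
          ENNReal.inv_mul_cancel h4 ENNReal.ofReal_ne_top, one_mul]
    _ = (∫⁻ r in Ioc 0 T, rayDensity wS g r) + ((∫⁻ r in Ioc T (2 * T), rayDensity wS g r) +
          ∫⁻ r in Ioi (2 * T), rayDensity wS g r) := by
        rw [lintegral_Ioi_eq_add hT0.le, lintegral_Ioi_eq_add (show T ≤ 2 * T by linarith)]
    _ ≤ ENNReal.ofReal aS + (ENNReal.ofReal ((ρ + 1) ^ 2 * C_H ^ 2 * θ₁) + ENNReal.ofReal c) +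
          (ENNReal.ofReal (ε / 2) + 0) := by
        rw [hP3]; exact add_le_add hP1 (add_le_add hP2 le_rfl)
    _ ≤ ENNReal.ofReal aS + (ENNReal.ofReal (ε / 2) + ENNReal.ofReal c) +
          (ENNReal.ofReal (ε / 2) + 0) := by
        gcongr
    _ = ENNReal.ofReal (aS + c) + ε := by
        rw [add_zero, ← ENNReal.ofReal_add (by positivity) hc0.le,
          ← ENNReal.ofReal_add haS0 (by positivity), ← ENNReal.ofReal_add (by positivity) (by positivity),
          ← ENNReal.ofReal_coe_nnreal, ← ENNReal.ofReal_add (by positivity) NNReal.zero_le_coe]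
        congr 1
        ring

end Regime1

/-! ### The second regime: `a ≤ φ(R_S)·a_</(1 - a_</R_S) + a_S` -/

section Regime2

variable {w : ℝ → ℝ≥0∞} {M R₀ ρ : ℝ}

/-- **Splitting `8πa = ∫wφ` at the cut radius** (the second regime of [FournaisSolovej2022,
Lemma 3.2]): with `w_< = w·1_{r ≤ ρ}` (scattering length `a_<`, read off at `ρ`) and the tail
`w_S = w·1_{(ρ,∞)}` (`a_S`): on the core `φ = c₀φ_<` with `c₀ = φ(ρ)/φ_<(ρ)`,
`φ_<(ρ) = 1 - a_</ρ`, and `φ ≤ φ_S` everywhere, so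
`a = ∫₀^{R₀} ½ws²φ ≤ φ(ρ)a_</(1 - a_</ρ) + a_S`.
[cite: FournaisSolovej2022, Lemma 3.2, proof, (3.23)–(3.24); FournaisEtAl2024, Lemma 3.4] -/
theorem odeScatteringLength_le_core_add_tail (hw : Measurable w) (hM : ∀ r, w r ≤ ENNReal.ofReal M)
    (hM0 : 0 ≤ M) (hR₀ : 0 < R₀) (hwR₀ : ∀ s, R₀ < s → w s = 0) (hρ : 0 < ρ) (hρR : ρ < R₀) :
    odeScatteringLength w R₀ ≤
      radialProfile w R₀ ρ * odeScatteringLength ((Iic ρ).indicator w) ρ /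
          (1 - odeScatteringLength ((Iic ρ).indicator w) ρ / ρ) +
        odeScatteringLength ((Ioi ρ).indicator w) R₀ := by
  -- the tail and the core potentials
  set wS : ℝ → ℝ≥0∞ := (Ioi ρ).indicator w with hwS
  have hmS : Measurable wS := hw.indicator measurableSet_Ioi
  have hbS : ∀ r, wS r ≤ ENNReal.ofReal M := fun r => by
    rw [hwS]; by_cases h : r ∈ Ioi ρ
    · rw [indicator_of_mem h]; exact hM r
    · rw [indicator_of_notMem h]; exact zero_le
  have hSR₀ : ∀ s, R₀ < s → wS s = 0 := fun s hs => by
    rw [hwS]; by_cases h : s ∈ Ioi ρ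
    · rw [indicator_of_mem h]; exact hwR₀ s hs
    · exact indicator_of_notMem h _
  have hSw : ∀ s, ρ < s → wS s = w s := fun s hs => indicator_of_mem (mem_Ioi.2 hs) _
  have hSle : ∀ r, wS r ≤ w r := fun r => indicator_le_self _ _ r
  set wL : ℝ → ℝ≥0∞ := (Iic ρ).indicator w with hwL
  have hmL : Measurable wL := hw.indicator measurableSet_Iic
  have hbL : ∀ r, wL r ≤ ENNReal.ofReal M := fun r => by
    rw [hwL]; by_cases h : r ∈ Iic ρ
    · rw [indicator_of_mem h]; exact hM r
    · rw [indicator_of_notMem h]; exact zero_le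
  have hLρ : ∀ s, ρ < s → wL s = 0 := fun s hs =>
    indicator_of_notMem (show s ∉ Iic ρ from not_le.2 hs) _
  have hLR₀ : ∀ s, R₀ < s → wL s = 0 := fun s hs => hLρ s (hρR.trans hs)
  have hLw : ∀ s, 0 < s → s ≤ ρ → wL s = w s := fun s _ hs => indicator_of_mem (mem_Iic.2 hs) _
  -- scattering lengths and profiles
  set a : ℝ := odeScatteringLength w R₀ with ha
  set aS : ℝ := odeScatteringLength wS R₀ with haS
  set aL : ℝ := odeScatteringLength wL ρ with haL
  have haL' : odeScatteringLength wL R₀ = aL := odeScatteringLength_eq_of_le_of_le hmL hbL hM0 hρ.le hLρ hρR.le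
  have haL0 : 0 ≤ aL := odeScatteringLength_nonneg hmL hbL hM0 hρ.le
  have haLρ : aL < ρ := odeScatteringLength_lt hmL hbL hM0 hρ
  have hden : 0 < 1 - aL / ρ := by rw [sub_pos, div_lt_one hρ]; exact haLρ
  set f := radialProfile w R₀ with hf
  set fS := radialProfile wS R₀ with hfS
  set fL := radialProfile wL R₀ with hfL
  have hfc : Continuous f := (contDiff_radialProfile hw hM hM0).continuous
  have hfSc : Continuous fS := (contDiff_radialProfile hmS hbS hM0).continuous
  have hfLc : Continuous fL := (contDiff_radialProfile hmL hbL hM0).continuous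
  have hf0 : ∀ r, 0 < f r := fun r => radialProfile_pos hw hM hM0 R₀ r
  have hfS0 : ∀ r, 0 < fS r := fun r => radialProfile_pos hmS hbS hM0 R₀ r
  have hffS : ∀ r, f r ≤ fS r := fun r => radialProfile_antitone_pot hmS hw hbS hM hM0 hSle hR₀ hwR₀ r
  -- `φ = c₀ φ_<` on the core: the radial solutions agree there
  set C : ℝ := radialSolDeriv w R₀ with hC
  set CL : ℝ := radialSolDeriv wL R₀ with hCL
  have hCpos : 0 < C := slope_pos hw hM hM0 R₀
  have hCLpos : 0 < CL := slope_pos hmL hbL hM0 R₀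
  have hu_eq : ∀ r, r ≤ ρ → radialSol wL r = radialSol w r := fun r hr =>
    radialSol_congr_Iic (fun s h1 h2 => hLw s h1 h2) hr
  have hffL : ∀ s, 0 < s → s ≤ ρ → f s = CL / C * fL s := by
    intro s hs hsρ
    rw [hf, hfL, radialProfile_of_pos w R₀ hs, radialProfile_of_pos wL R₀ hs, hu_eq s hsρ, ← hC, ← hCL]
    field_simp
  have hfLρ : fL ρ = 1 - aL / ρ := by
    rw [hfL, radialProfile_eq_one_sub_div_self hmL hbL hM0 hρ hρR.le hLρ, haL']
  have hratio : CL / C = f ρ / fL ρ := by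
    have h := hffL ρ hρ le_rfl
    have hfL0 : fL ρ ≠ 0 := (radialProfile_pos hmL hbL hM0 R₀ ρ).ne'
    rw [h]; field_simp
  -- the integrands
  have hI : IntegrableOn (fun s => (w s).toReal / 2 * s ^ 2 * f s) (Ioc 0 R₀) :=
    (integrableOn_half_pot_sq hw hM hM0 0 R₀).mul_continuousOn_of_subset hfc.continuousOn
      measurableSet_Ioc isCompact_Icc Ioc_subset_Icc_self
  have hIS : IntegrableOn (fun s => (wS s).toReal / 2 * s ^ 2 * fS s) (Ioc 0 R₀) :=
    (integrableOn_half_pot_sq hmS hbS hM0 0 R₀).mul_continuousOn_of_subset hfSc.continuousOn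
      measurableSet_Ioc isCompact_Icc Ioc_subset_Icc_self
  have hIL : IntegrableOn (fun s => (wL s).toReal / 2 * s ^ 2 * fL s) (Ioc 0 R₀) :=
    (integrableOn_half_pot_sq hmL hbL hM0 0 R₀).mul_continuousOn_of_subset hfLc.continuousOn
      measurableSet_Ioc isCompact_Icc Ioc_subset_Icc_self
  have hnnS : ∀ s, 0 ≤ (wS s).toReal / 2 * s ^ 2 * fS s := fun s => by
    have := (hfS0 s).le; positivity
  have hnnL : ∀ s, 0 ≤ (wL s).toReal / 2 * s ^ 2 * fL s := fun s => by
    have := (radialProfile_pos hmL hbL hM0 R₀ s).le; positivity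
  -- `a = ∫₀^ρ + ∫_ρ^{R₀}`
  have hsplit : a = (∫ s in Ioc 0 ρ, (w s).toReal / 2 * s ^ 2 * f s) +
      ∫ s in Ioc ρ R₀, (w s).toReal / 2 * s ^ 2 * f s := by
    rw [ha, ← integral_pot_sq_profile hw hM hM0 hR₀ hwR₀, ← hf, ← Ioc_union_Ioc_eq_Ioc hρ.le hρR.le,
      setIntegral_union (Ioc_disjoint_Ioc_of_le le_rfl) measurableSet_Ioc
        (hI.mono_set (Ioc_subset_Ioc_right hρR.le)) (hI.mono_set (Ioc_subset_Ioc_left hρ.le))]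
  -- the tail part is at most `a_S`
  have htail : ∫ s in Ioc ρ R₀, (w s).toReal / 2 * s ^ 2 * f s ≤ aS := by
    calc ∫ s in Ioc ρ R₀, (w s).toReal / 2 * s ^ 2 * f s
        ≤ ∫ s in Ioc ρ R₀, (wS s).toReal / 2 * s ^ 2 * fS s := by
          refine setIntegral_mono_on (hI.mono_set (Ioc_subset_Ioc_left hρ.le))
            (hIS.mono_set (Ioc_subset_Ioc_left hρ.le)) measurableSet_Ioc fun s hs => ?_
          rw [hSw s hs.1]
          have h0 : 0 ≤ (w s).toReal / 2 * s ^ 2 := by positivity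
          exact mul_le_mul_of_nonneg_left (hffS s) h0
      _ ≤ ∫ s in Ioc 0 R₀, (wS s).toReal / 2 * s ^ 2 * fS s :=
          setIntegral_mono_set hIS (Eventually.of_forall hnnS) (Ioc_subset_Ioc_left hρ.le).eventuallyLE
      _ = aS := by rw [haS, hfS, integral_pot_sq_profile hmS hbS hM0 hR₀ hSR₀]
  -- the core part is `c₀ a_<`
  have hcore : ∫ s in Ioc 0 ρ, (w s).toReal / 2 * s ^ 2 * f s = CL / C * aL := by
    calc ∫ s in Ioc 0 ρ, (w s).toReal / 2 * s ^ 2 * f s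
        = ∫ s in Ioc 0 ρ, CL / C * ((wL s).toReal / 2 * s ^ 2 * fL s) := by
          refine setIntegral_congr_fun measurableSet_Ioc fun s hs => ?_
          rw [hffL s hs.1 hs.2, hLw s hs.1 hs.2]; ring
      _ = CL / C * ∫ s in Ioc 0 ρ, (wL s).toReal / 2 * s ^ 2 * fL s := integral_const_mul _ _
      _ = CL / C * ∫ s in Ioc 0 R₀, (wL s).toReal / 2 * s ^ 2 * fL s := by
          congr 1
          rw [← Ioc_union_Ioc_eq_Ioc hρ.le hρR.le,
            setIntegral_union (Ioc_disjoint_Ioc_of_le le_rfl) measurableSet_Ioc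
              (hIL.mono_set (Ioc_subset_Ioc_right hρR.le)) (hIL.mono_set (Ioc_subset_Ioc_left hρ.le)),
            setIntegral_eq_zero_of_forall_eq_zero (t := Ioc ρ R₀) fun s hs => ?_, add_zero]
          rw [hLρ s hs.1]; simp
      _ = CL / C * aL := by rw [integral_pot_sq_profile hmL hbL hM0 hR₀ hLR₀, haL']
  -- conclusion
  rw [hsplit, hcore, hratio, hfLρ]
  have h1 : f ρ / (1 - aL / ρ) * aL = f ρ * aL / (1 - aL / ρ) := by ring
  rw [h1]
  exact add_le_add le_rfl htail

end Regime2

/-! ### FGJMOT Lemma 3.4 -/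

section Lemma34

variable {w : ℝ → ℝ≥0∞} {M R₀ : ℝ}

/-- **FGJMOT Lemma 3.4 / Fournais–Solovej II, Lemma 3.2 (bounded profiles, constant `C₀ = 2`).**
Let `w ≤ M` be a bounded measurable radial profile of finite range `R₀` with scattering length
`a = a(w) > 0` (ODE scattering length read off at `R₀`, `= scatteringLength w`), and let `S > 0` with
`S·a < m(0) = ∫₀^{R₀} ½w(s)s² ds` (i.e. `8πS a < ∫ w`; otherwise `w_S := w` and there is nothing to
prove). Then there is a cut radius `0 < R_S < R₀` with tail mass `m(R_S) = ∫_{R_S}^{R₀} ½ws² = S a`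
(i.e. `∫ w_S = 8πS a(w)`), and the tail `w_S = w·1_{(R_S,∞)}` satisfies
`a ≥ a(w_S) ≥ a(1 - 2/S)`. (FGJMOT: `a(V) ≥ a(V_S) ≥ a(V)(1 - C₀S⁻¹)` with a universal `C₀`;
Fournais–Solovej: `a(v_T) ≥ a(v)(1 - (1 + √5/√T)T⁻¹)`.) Proof: `R_S ≤ 2a` →
`odeScatteringLength_le_tail_add` with `R_Sφ_S(R_S) ≤ R_S a_S/(aS) ≤ 2a/S`; `R_S > 2a` →
`odeScatteringLength_le_core_add_tail` with `φ(R_S) ≤ 1/S`, `a_< ≤ a < R_S/2`.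
[cite: FournaisEtAl2024, Lemma 3.4; FournaisSolovej2022, Thm. 1.6 and Lemma 3.2] -/
theorem FournaisEtAl2024_lemma34 (hw : Measurable w) (hM : ∀ r, w r ≤ ENNReal.ofReal M) (hM0 : 0 ≤ M)
    (hR₀ : 0 < R₀) (hwR₀ : ∀ s, R₀ < s → w s = 0) (ha : 0 < odeScatteringLength w R₀) {S : ℝ}
    (hS : 0 < S) (hmass : S * odeScatteringLength w R₀ < ∫ s in Ioc 0 R₀, (w s).toReal / 2 * s ^ 2) :
    ∃ ρ : ℝ, 0 < ρ ∧ ρ < R₀ ∧ (∫ s in Ioc ρ R₀, (w s).toReal / 2 * s ^ 2) = S * odeScatteringLength w R₀ ∧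
      odeScatteringLength w R₀ * (1 - 2 / S) ≤ odeScatteringLength ((Ioi ρ).indicator w) R₀ ∧
      odeScatteringLength ((Ioi ρ).indicator w) R₀ ≤ odeScatteringLength w R₀ := by
  set a : ℝ := odeScatteringLength w R₀ with ha_def
  obtain ⟨ρ, hρ, hρR, hmρ⟩ := exists_tailMass_eq hw hM hM0 hR₀ (mul_pos hS ha) hmass
  -- the tail potential
  set wS : ℝ → ℝ≥0∞ := (Ioi ρ).indicator w with hwS
  have hmS : Measurable wS := hw.indicator measurableSet_Ioi
  have hbS : ∀ r, wS r ≤ ENNReal.ofReal M := fun r => by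
    rw [hwS]; by_cases h : r ∈ Ioi ρ
    · rw [indicator_of_mem h]; exact hM r
    · rw [indicator_of_notMem h]; exact zero_le
  have hSle : ∀ r, wS r ≤ w r := fun r => indicator_le_self _ _ r
  have hSR₀ : ∀ s, R₀ < s → wS s = 0 := fun s hs => by
    rw [hwS]; by_cases h : s ∈ Ioi ρ
    · rw [indicator_of_mem h]; exact hwR₀ s hs
    · exact indicator_of_notMem h _
  have hSw : ∀ s, ρ < s → wS s = w s := fun s hs => indicator_of_mem (mem_Ioi.2 hs) _
  set aS : ℝ := odeScatteringLength wS R₀ with haS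
  have haS0 : 0 ≤ aS := odeScatteringLength_nonneg hmS hbS hM0 hR₀.le
  have haSa : aS ≤ a := odeScatteringLength_mono_pot hmS hw hbS hM hM0 hSle hR₀ hwR₀
  refine ⟨ρ, hρ, hρR, hmρ, ?_, haSa⟩
  -- the tail mass of `w_S` is that of `w`
  have hmS' : ∫ s in Ioc ρ R₀, (wS s).toReal / 2 * s ^ 2 = S * a := by
    rw [← hmρ]
    exact setIntegral_congr_fun measurableSet_Ioc fun s hs => by rw [hSw s hs.1]
  -- `φ_S(ρ) S a ≤ a_S` and `φ(ρ) S a ≤ a`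
  have hφS : radialProfile wS R₀ ρ * (S * a) ≤ aS := by
    rw [← hmS']; exact radialProfile_mul_tailMass_le hmS hbS hM0 hR₀ hSR₀ hρ.le
  have hφ : radialProfile w R₀ ρ * (S * a) ≤ a := by
    rw [← hmρ]; exact radialProfile_mul_tailMass_le hw hM hM0 hR₀ hwR₀ hρ.le
  have hSa : 0 < S * a := mul_pos hS ha
  suffices h : a ≤ aS + 2 * a / S by
    have : a * (1 - 2 / S) = a - 2 * a / S := by ring
    linarith
  rcases le_or_gt ρ (2 * a) with hρa | hρa
  · -- first regime
    have h1 := odeScatteringLength_le_tail_add hw hM hM0 hR₀ hwR₀ hρ hρR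
    have hφS' : radialProfile wS R₀ ρ ≤ aS / (S * a) := (le_div_iff₀ hSa).2 hφS
    have hφS0 : 0 ≤ radialProfile wS R₀ ρ := (radialProfile_pos hmS hbS hM0 R₀ ρ).le
    have h2 : ρ * radialProfile wS R₀ ρ ≤ 2 * a / S := by
      calc ρ * radialProfile wS R₀ ρ ≤ 2 * a * (aS / (S * a)) := mul_le_mul hρa hφS' hφS0 (by linarith)
        _ = 2 * aS / S := by field_simp
        _ ≤ 2 * a / S := by gcongr
    linarith
  · -- second regime
    have h1 := odeScatteringLength_le_core_add_tail hw hM hM0 hR₀ hwR₀ hρ hρR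
    set wL : ℝ → ℝ≥0∞ := (Iic ρ).indicator w with hwL
    have hmL : Measurable wL := hw.indicator measurableSet_Iic
    have hbL : ∀ r, wL r ≤ ENNReal.ofReal M := fun r => by
      rw [hwL]; by_cases h : r ∈ Iic ρ
      · rw [indicator_of_mem h]; exact hM r
      · rw [indicator_of_notMem h]; exact zero_le
    have hLle : ∀ r, wL r ≤ w r := fun r => indicator_le_self _ _ r
    have hLρ : ∀ s, ρ < s → wL s = 0 := fun s hs =>
      indicator_of_notMem (show s ∉ Iic ρ from not_le.2 hs) _
    set aL : ℝ := odeScatteringLength wL ρ with haL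
    have haL0 : 0 ≤ aL := odeScatteringLength_nonneg hmL hbL hM0 hρ.le
    have haLa : aL ≤ a := by
      rw [haL, ← odeScatteringLength_eq_of_le_of_le hmL hbL hM0 hρ.le hLρ hρR.le]
      exact odeScatteringLength_mono_pot hmL hw hbL hM hM0 hLle hR₀ hwR₀
    have hφ' : radialProfile w R₀ ρ ≤ 1 / S := by
      rw [le_div_iff₀ hS]
      nlinarith [hφ]
    have hφ0 : 0 ≤ radialProfile w R₀ ρ := (radialProfile_pos hw hM hM0 R₀ ρ).le
    have hden : 1 / 2 ≤ 1 - aL / ρ := by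
      have : aL / ρ ≤ 1 / 2 := by
        rw [div_le_iff₀ hρ]; linarith
      linarith
    have h2 : radialProfile w R₀ ρ * aL / (1 - aL / ρ) ≤ 2 * a / S := by
      rw [div_le_iff₀ (by linarith)]
      calc radialProfile w R₀ ρ * aL ≤ 1 / S * a := mul_le_mul hφ' haLa haL0 (by positivity)
        _ = 2 * a / S * (1 / 2) := by ring
        _ ≤ 2 * a / S * (1 - aL / ρ) := mul_le_mul_of_nonneg_left hden (by positivity)
    linarith

/-- **Variational form of Lemma 3.4**: the same statement for `scatteringLength` (LSSY Thm. C.1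
identification for the bounded finite-range potentials `w` and `w_S`).
[cite: FournaisEtAl2024, Lemma 3.4; LSSY2005, App. C, Thm. C.1] -/
theorem FournaisEtAl2024_lemma34_scatteringLength (hw : Measurable w) (hM : ∀ r, w r ≤ ENNReal.ofReal M)
    (hM0 : 0 ≤ M) (hR₀ : 0 < R₀) (hwR₀ : ∀ s, R₀ < s → w s = 0) (ha : 0 < (scatteringLength w).toReal)
    {S : ℝ} (hS : 0 < S)
    (hmass : S * (scatteringLength w).toReal < ∫ s in Ioc 0 R₀, (w s).toReal / 2 * s ^ 2) :
    ∃ ρ : ℝ, 0 < ρ ∧ ρ < R₀ ∧ (∫ s in Ioc ρ R₀, (w s).toReal / 2 * s ^ 2) = S * (scatteringLength w).toReal ∧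
      (scatteringLength w).toReal * (1 - 2 / S) ≤ (scatteringLength ((Ioi ρ).indicator w)).toReal ∧
      scatteringLength ((Ioi ρ).indicator w) ≤ scatteringLength w := by
  have haw := toReal_scatteringLength_eq hw hM hM0 hR₀ hwR₀
  rw [haw] at ha hmass ⊢
  obtain ⟨ρ, hρ, hρR, hm, hlow, -⟩ := FournaisEtAl2024_lemma34 hw hM hM0 hR₀ hwR₀ ha hS hmass
  refine ⟨ρ, hρ, hρR, hm, ?_, scatteringLength_mono fun r => indicator_le_self _ _ r⟩
  have hmS : Measurable ((Ioi ρ).indicator w) := hw.indicator measurableSet_Ioi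
  have hbS : ∀ r, (Ioi ρ).indicator w r ≤ ENNReal.ofReal M := fun r => by
    by_cases h : r ∈ Ioi ρ
    · rw [indicator_of_mem h]; exact hM r
    · rw [indicator_of_notMem h]; exact zero_le
  have hSR₀ : ∀ s, R₀ < s → (Ioi ρ).indicator w s = 0 := fun s hs => by
    by_cases h : s ∈ Ioi ρ
    · rw [indicator_of_mem h]; exact hwR₀ s hs
    · exact indicator_of_notMem h _
  rwa [toReal_scatteringLength_eq hmS hbS hM0 hR₀ hSR₀]

end Lemma34

end Literature.MathematicalPhysics.QuantumManyBody.BoseGas
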